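import Summits.CriticalPhenomena.PercolationContinuityZ3.Theorems.FK.LocalEventInterlacing
import Summits.CriticalPhenomena.PercolationContinuityZ3.Theorems.FK.DLRSandwich
import Summits.CriticalPhenomena.PercolationContinuityZ3.Theorems.FK.DomainMarkovExtremalityLimits
import Summits.CriticalPhenomena.PercolationContinuityZ3.Theorems.FK.FreeWiredCoincidence
import HarnessLib

/-!
# FK-continuity transplant, FO-06/FO-10 (infinite-volume structure): the classes `R_{p,q}` are STOCHASTICALLY ORDERED in
# `p` — for `p < p'` every member of `R_{p,q}` lies below every member of `R_{p',q}` on increasing local events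
# (Grimmett 2006, (4.35) with the interlacing `φ¹_{p,q} ≤ φ⁰_{p',q}` of Thm. (4.63)/(5.16))

Registered R95 (cell INBOX l.6599, 2026-08-24); registry row FO-10b-g410; label DNX-B (coordinator fk-4 g198).
Cell `fk-continuity` (bschramm), FO-10b lineage; `--supports stmt-CriticalPhenomena-4575`; builds on p205010 (kernel theorem,
internal audit signed; external expert review pending). CONDITIONAL cell (FH AND TP_FK open at the same `p` for `q > 1`; K1);
UNCONDITIONAL structure here (every `d`, `0 < p < 1`, `q ≥ 1`); no defs / sorries; NOT a discharge, NOT `_r4`; n_open = 2.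
Banked infinite-volume structure; not an END-STATE dependency of the cell (not consumed by `_r3`).

* `FKGibbs.real_le_of_lt` — for `0 ≤ p < p' ≤ 1`, `q ≥ 1`, `P ∈ FKGibbs d p q`, `P' ∈ FKGibbs d p' q` and an increasing event
  `A` determined by the lattice edges of a finite region: `P(A) ≤ P'(A)` — the sandwich `P ≤ φ¹_{p,q}`, `φ⁰_{p',q} ≤ P'`
  (FO-10a `FKGibbs.real_le_rcLimit_true` / `rcLimit_false_real_le`) around FO-10a-g337p's interlacing
  `φ¹_{p,q} ≤ φ⁰_{p',q}` (`rcLimit_true_real_le_rcLimit_false_real_of_lt`);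
* **`IsDLRRandomCluster.real_le_of_lt`** — the same for `P ∈ R_{p,q}`, `P' ∈ R_{p',q}` carried by lattice configurations,
  `0 < p < p' < 1` (via FO-10a `IsDLRRandomCluster.fkGibbs`): the DLR classes at different parameters never interlace
  the wrong way, whatever the (non-)uniqueness at `p` and `p'`;
* `IsDLRRandomCluster.eq_rcLimit_false_of_edgeDensity_eq`, `countable_setOf_exists_isDLRRandomCluster_ne_rcLimit` —
  **Thm. (4.63) for `R_{p,q}`**: at every `p` with `h⁰(p,q) = h¹(p,q)` the lattice-carried members of `R_{p,q}` are
  exactly `{φ⁰_{p,q}}`, hence `|R_{p,q}| = 1` off a countable set of `p` (FO-07b `FreeWiredCoincidence` read on the DLR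
  class through `R_{p,q} ⊆ FKGibbs`).

## References

* G. Grimmett, *The Random-Cluster Model*, Springer 2006: Thm. (4.34)(b) eq. (4.35)–(4.36), Thm. (4.60)/(4.63), Thm. (5.16)
  and their proofs (the interlacing of free and wired measures at different `p`), pp. 82, 89, 103. [Grimmett2006]
-/

noncomputable section

open MeasureTheory Set

namespace Summit.CriticalPhenomena.PercolationContinuityZ3.Theorems.FK

open Literature.Probability.Percolation Literature.Probability.LatticeModels

variable {d : ℕ} {p p' q : ℝ} {P P' : Measure (BondConfig (Site d))}

/-- **The sandwich classes are stochastically ordered in `p`**: for `0 ≤ p < p' ≤ 1`, `q ≥ 1`, `P ∈ FKGibbs d p q`,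
`P' ∈ FKGibbs d p' q` and an increasing event `A` determined by the edges `E_Λ` of a finite region,
`P(A) ≤ φ¹_{p,q}(A) ≤ φ⁰_{p',q}(A) ≤ P'(A)`. [cite: Grimmett2006, Thm. (4.34)(b) eq. (4.35), Thm. (5.16) (proof, interlacing)] -/
theorem FKGibbs.real_le_of_lt (hP : FKGibbs d p q P) (hP' : FKGibbs d p' q P') (hp : p ∈ Set.Icc (0 : ℝ) 1)
    (hp' : p' ∈ Set.Icc (0 : ℝ) 1) (hlt : p < p') (hq : 1 ≤ q) {A : Set (BondConfig (Site d))} {Λ : Finset (Site d)}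
    (hA : IsUpperSet A) (hAΛ : DeterminedBy A ↑(edgesIn (zdGraph d) Λ)) : P.real A ≤ P'.real A :=
  calc P.real A ≤ (rcLimit d true p q).real A := hP.real_le_rcLimit_true hp hq hA hAΛ
    _ ≤ (rcLimit d false p' q).real A := rcLimit_true_real_le_rcLimit_false_real_of_lt hq hp hp' hlt hA hAΛ
    _ ≤ P'.real A := hP'.rcLimit_false_real_le hp' hq hA hAΛ

/-- **The DLR classes `R_{p,q}` are stochastically ordered in `p`**: for `0 < p < p' < 1`, `q ≥ 1`, `P ∈ R_{p,q}` and
`P' ∈ R_{p',q}` carried by lattice configurations, and an increasing event `A` determined by the edges of a finite region,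
`P(A) ≤ P'(A)`. [cite: Grimmett2006, Thm. (4.34)(b) eq. (4.35), Thm. (5.16) (proof, interlacing)] -/
theorem IsDLRRandomCluster.real_le_of_lt (hP : IsDLRRandomCluster d p q P) (hP' : IsDLRRandomCluster d p' q P')
    (hp : p ∈ Set.Ioo (0 : ℝ) 1) (hp' : p' ∈ Set.Ioo (0 : ℝ) 1) (hlt : p < p') (hq : 1 ≤ q)
    (hlat : ∀ᵐ ω ∂P, ω ⊆ (zdGraph d).edgeSet) (hlat' : ∀ᵐ ω ∂P', ω ⊆ (zdGraph d).edgeSet)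
    {A : Set (BondConfig (Site d))} {Λ : Finset (Site d)} (hA : IsUpperSet A)
    (hAΛ : DeterminedBy A ↑(edgesIn (zdGraph d) Λ)) : P.real A ≤ P'.real A :=
  (hP.fkGibbs hp hq hlat).real_le_of_lt (hP'.fkGibbs hp' hq hlat') ⟨hp.1.le, hp.2.le⟩ ⟨hp'.1.le, hp'.2.le⟩ hlt hq hA hAΛ

/-! ### Thm. (4.63) read on `R_{p,q}`: uniqueness off a countable set -/

/-- **At a point of edge-density continuity the DLR class is `{φ⁰_{p,q}}`** (Grimmett 2006, Thm. (4.63) with (4.36)): if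
`h⁰(p,q) = h¹(p,q)` on every lattice edge (`0 < p < 1`, `q ≥ 1`), every `P ∈ R_{p,q}` carried by lattice configurations
equals `φ⁰_{p,q}`. [cite: Grimmett2006, Thm. (4.63)] -/
theorem IsDLRRandomCluster.eq_rcLimit_false_of_edgeDensity_eq (hP : IsDLRRandomCluster d p q P) (hp : p ∈ Set.Ioo (0 : ℝ) 1)
    (hq : 1 ≤ q) (hlat : ∀ᵐ ω ∂P, ω ⊆ (zdGraph d).edgeSet)
    (hgood : ∀ e ∈ (zdGraph d).edgeSet, freeEdgeDensity d p q e = wiredEdgeDensity d p q e) : P = rcLimit d false p q :=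
  (hP.fkGibbs hp hq hlat).eq_rcLimit_of_edgeDensity_eq ⟨hp.1.le, hp.2.le⟩ hq hgood

/-- **`|R_{p,q}| = 1` off a countable set of `p`** (Grimmett 2006, Thm. (4.63): "there is exactly one random-cluster
measure when `p ∉ 𝒟_q`"): for `q ≥ 1` the set of `p ∈ (0,1)` admitting a lattice-carried DLR random-cluster measure other
than `φ⁰_{p,q}` is countable. [cite: Grimmett2006, Thm. (4.63)] -/
theorem countable_setOf_exists_isDLRRandomCluster_ne_rcLimit {q : ℝ} (hq : 1 ≤ q) :
    {p : ℝ | p ∈ Set.Ioo (0 : ℝ) 1 ∧ ∃ P : Measure (BondConfig (Site d)),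
      IsDLRRandomCluster d p q P ∧ (∀ᵐ ω ∂P, ω ⊆ (zdGraph d).edgeSet) ∧ P ≠ rcLimit d false p q}.Countable := by
  refine (countable_setOf_exists_fkGibbs_ne_rcLimit (d := d) hq).mono fun p hp => ?_
  rcases hp with ⟨hpI, P, hP, hlat, hne⟩
  exact ⟨⟨hpI.1.le, hpI.2.le⟩, P, hP.fkGibbs hpI hq hlat, hne⟩

end Summit.CriticalPhenomena.PercolationContinuityZ3.Theorems.FK

end
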